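import Literature.RepresentationTheory.KonnoKonno2007.U21KAKSection
import HarnessLib

/-!
# An explicit differentiable `KAK` section of `U(2,1)` off `K` — II: on the group

Topic `RepresentationTheory/KonnoKonno2007`; namespace `Literature.RepresentationTheory.KonnoKonno2007.RealDualPair`; sequel of ★ `U21KAKSection`
(the total functions `secT`, `secU`, `secZ`, `secK₂`, `secK₂Inv`, `secK₁`, `secU₁` of a `3 × 3` complex matrix and their algebra).  KERNEL ONLY: three
plumbing definitions with bodies (the packaged `K`-elements `secKV₂`, `secKV₁` and the group element `secK₁Elt`) and proved theorems; no structure, no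
instance, no notation, no named fact, no `sorry`.  Cell `hodgecm-mathlib`, F0∕P3, ROAD-GLOB v1.1 brick «S1b» (letter A6 at `U(2,1)`).

For `g ∈ U(2,1) = UForm (Fin 2) (Fin 1)` with last row `(r, c)`:
* §1 the ROW form `g J gᴴ = J` of the defining relation (`coe_mul_signForm_mul_conjTranspose`, from `gᴴ J g = J`, `J² = 1`, `mul_eq_one_comm`), hence
  **`|g₃₃|² = 1 + ‖r‖²`**, `g₃₃ ≠ 0`, `|g₃₃| = cosh (secT g) = gauge 0 g`, and **`‖r‖ = 0 ↔ g ∈ K`** (`rowNorm_eq_zero_iff_exists_kV`, via ★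
  `exists_kV_eq_of_gauge_eq_one`), `0 < secT g` off `K`;
* §2 off `K` (`‖r‖ ≠ 0`): `secKV₂ g = (secU g, g₃₃∕|g₃₃|) ∈ U(2) × U(1)` with `↑(kV (secKV₂ g)) = secK₂ g` and `↑(kV (secKV₂ g))⁻¹ = secK₂Inv g`; the element
  `secK₁Elt g = g · (kV (secKV₂ g))⁻¹ · a_{−secT g}` has matrix `secK₁ g`, last row `(0, 0, 1)`, hence gauge `1`, hence lies in `K`:
  **`exists_kV_coe_eq_secK₁`**, **`exists_kV_coe_eq_secK₂`** (`∃ k : KV, ↑(kV k) = secKᵢ g`), the SECTION IDENTITY on the group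
  **`coe_eq_secK₁_mul_hypV_mul_secK₂ : ↑g = secK₁ g · ↑(a_{secT g}) · secK₂ g`**, `exists_kakMap_eq`, and the fully explicit form
  `secKV₁ g = (secU₁ g, 1)`, **`kakMap_secKV : kakMap 0 0 (secKV₁ g, secT g, secKV₂ g) = g`**.

Provenance (statement shape only): [Knapp2002, VII §3 Thm. 7.39], [Helgason1978, Ch. IX Thm. 1.1].

## References
* [Knapp2002] A. W. Knapp, *Lie Groups Beyond an Introduction*, 2nd ed. (2002), I §1 Example (3), VII §3 Thm. 7.39.
* [Helgason1978] S. Helgason, *Differential Geometry, Lie Groups, and Symmetric Spaces*, Ch. IX Thm. 1.1.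
-/

set_option autoImplicit false

noncomputable section

open Matrix Complex Topology Filter
open scoped ComplexConjugate MatrixGroups
open NormedSpace

namespace Literature.RepresentationTheory.KonnoKonno2007

namespace RealDualPair

open Literature.NumberTheory.Automorphic Literature.RepresentationTheory.BorelWallach2000

/-! ## §5 On `U(2,1)`: the row relation, `k₁ ∈ K`, and the section through `kakMap` -/

section OnGroup

open UForm

variable (g : UForm (Fin 2) (Fin 1))

/-- **the row form of the defining relation**: `g J gᴴ = J` for `g ∈ U(2,1)` (from `gᴴ J g = J`, ★ `mem_unitaryGroupOfForm_star_iff_conjTranspose`,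
`J² = 1` and `Matrix.mul_eq_one_comm`). [cite: Knapp2002, I §1 Example (3), VII §3 Thm. 7.39] -/
theorem coe_mul_signForm_mul_conjTranspose :
    (((g : UForm (Fin 2) (Fin 1)) : GL (Fin 2 ⊕ Fin 1) ℂ) : Matrix (Fin 2 ⊕ Fin 1) (Fin 2 ⊕ Fin 1) ℂ) * signForm (Fin 2) (Fin 1) *
        (((g : UForm (Fin 2) (Fin 1)) : GL (Fin 2 ⊕ Fin 1) ℂ) : Matrix (Fin 2 ⊕ Fin 1) (Fin 2 ⊕ Fin 1) ℂ)ᴴ = signForm (Fin 2) (Fin 1) := by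
  set M := (((g : UForm (Fin 2) (Fin 1)) : GL (Fin 2 ⊕ Fin 1) ℂ) : Matrix (Fin 2 ⊕ Fin 1) (Fin 2 ⊕ Fin 1) ℂ) with hM
  set J := signForm (Fin 2) (Fin 1) with hJ
  have h : Mᴴ * J * M = J := (mem_unitaryGroupOfForm_star_iff_conjTranspose _ _).1 g.2
  have hJJ : J * J = 1 := by
    rw [hJ, signForm, Matrix.fromBlocks_multiply]; simp
  have h1 : (J * Mᴴ * J) * M = 1 := by
    calc (J * Mᴴ * J) * M = J * (Mᴴ * J * M) := by simp only [Matrix.mul_assoc]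
      _ = 1 := by rw [h, hJJ]
  have h2 : M * (J * Mᴴ * J) = 1 := mul_eq_one_comm.1 h1
  calc M * J * Mᴴ = M * J * Mᴴ * (J * J) := by rw [hJJ, Matrix.mul_one]
    _ = M * (J * Mᴴ * J) * J := by simp only [Matrix.mul_assoc]
    _ = J := by rw [h2, Matrix.one_mul]

/-- **`|g₃₃|² = 1 + ‖r‖²`** — the `(3,3)` entry of `g J gᴴ = J`. [cite: Knapp2002, I §1 Example (3), VII §3 Thm. 7.39] -/
theorem norm_corner_sq_eq :
    ‖(((g : UForm (Fin 2) (Fin 1)) : GL (Fin 2 ⊕ Fin 1) ℂ) : Matrix (Fin 2 ⊕ Fin 1) (Fin 2 ⊕ Fin 1) ℂ) (Sum.inr 0) (Sum.inr 0)‖ ^ 2 =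
      1 + rowNorm (((g : UForm (Fin 2) (Fin 1)) : GL (Fin 2 ⊕ Fin 1) ℂ) : Matrix (Fin 2 ⊕ Fin 1) (Fin 2 ⊕ Fin 1) ℂ) ^ 2 := by
  set M := (((g : UForm (Fin 2) (Fin 1)) : GL (Fin 2 ⊕ Fin 1) ℂ) : Matrix (Fin 2 ⊕ Fin 1) (Fin 2 ⊕ Fin 1) ℂ) with hM
  have h := congrFun (congrFun (coe_mul_signForm_mul_conjTranspose g) (Sum.inr 0)) (Sum.inr 0)
  rw [← hM, signForm_eq_diagonal, Matrix.mul_apply, Fintype.sum_sum_type, Fin.sum_univ_two,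
    Fintype.sum_subsingleton _ (0 : Fin 1)] at h
  simp only [Matrix.mul_diagonal, Matrix.conjTranspose_apply, Sum.elim_inl, Sum.elim_inr, mul_one, mul_neg_one,
    Matrix.diagonal_apply_eq, Complex.star_def, neg_mul, Complex.mul_conj, Complex.normSq_eq_norm_sq] at h
  have h' : ((‖M (Sum.inr 0) (Sum.inl 0)‖ ^ 2 + ‖M (Sum.inr 0) (Sum.inl 1)‖ ^ 2 - ‖M (Sum.inr 0) (Sum.inr 0)‖ ^ 2 : ℝ) : ℂ) =
      ((-1 : ℝ) : ℂ) := by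
    push_cast at h ⊢
    linear_combination h
  have h'' := Complex.ofReal_injective h'
  rw [rowNorm_sq]
  linarith

/-- `|g₃₃| ≥ 1` on `U(2,1)`. [cite: Knapp2002, I §1 Example (3), VII §3 Thm. 7.39] -/
theorem one_le_norm_corner :
    1 ≤ ‖(((g : UForm (Fin 2) (Fin 1)) : GL (Fin 2 ⊕ Fin 1) ℂ) : Matrix (Fin 2 ⊕ Fin 1) (Fin 2 ⊕ Fin 1) ℂ) (Sum.inr 0) (Sum.inr 0)‖ := by
  have h := norm_corner_sq_eq g
  nlinarith [norm_nonneg ((((g : UForm (Fin 2) (Fin 1)) : GL (Fin 2 ⊕ Fin 1) ℂ) : Matrix (Fin 2 ⊕ Fin 1) (Fin 2 ⊕ Fin 1) ℂ) (Sum.inr 0) (Sum.inr 0)),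
    sq_nonneg (rowNorm (((g : UForm (Fin 2) (Fin 1)) : GL (Fin 2 ⊕ Fin 1) ℂ) : Matrix (Fin 2 ⊕ Fin 1) (Fin 2 ⊕ Fin 1) ℂ))]

/-- **`g₃₃ ≠ 0`** on `U(2,1)`. [cite: Knapp2002, I §1 Example (3), VII §3 Thm. 7.39] -/
theorem corner_ne_zero :
    (((g : UForm (Fin 2) (Fin 1)) : GL (Fin 2 ⊕ Fin 1) ℂ) : Matrix (Fin 2 ⊕ Fin 1) (Fin 2 ⊕ Fin 1) ℂ) (Sum.inr 0) (Sum.inr 0) ≠ 0 := by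
  intro h
  have h1 := one_le_norm_corner g
  rw [h, norm_zero] at h1
  exact absurd h1 (by norm_num)

/-- **`|g₃₃| = cosh (secT g)`** on `U(2,1)`. [cite: Knapp2002, VII §3 Thm. 7.39] -/
theorem norm_corner_eq_cosh_secT :
    ‖(((g : UForm (Fin 2) (Fin 1)) : GL (Fin 2 ⊕ Fin 1) ℂ) : Matrix (Fin 2 ⊕ Fin 1) (Fin 2 ⊕ Fin 1) ℂ) (Sum.inr 0) (Sum.inr 0)‖ =
      Real.cosh (secT (((g : UForm (Fin 2) (Fin 1)) : GL (Fin 2 ⊕ Fin 1) ℂ) : Matrix (Fin 2 ⊕ Fin 1) (Fin 2 ⊕ Fin 1) ℂ)) := by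
  rw [cosh_secT, ← norm_corner_sq_eq, Real.sqrt_sq (norm_nonneg _)]

/-- the gauge of S1a is `|g₃₃|`: `gauge 0 g = cosh (secT g)`. [cite: Knapp2002, VII §3 Thm. 7.39] -/
theorem gauge_eq_cosh_secT :
    gauge (0 : Fin 1) g = Real.cosh (secT (((g : UForm (Fin 2) (Fin 1)) : GL (Fin 2 ⊕ Fin 1) ℂ) : Matrix (Fin 2 ⊕ Fin 1) (Fin 2 ⊕ Fin 1) ℂ)) :=
  norm_corner_eq_cosh_secT g

/-- **`‖r‖ = 0 ↔ g ∈ K`** (`K` = the image of ★ `UForm.kV`): `⇐` block shape, `⇒` ★ `exists_kV_eq_of_gauge_eq_one` (`|g₃₃| = cosh 0 = 1`).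
[cite: Knapp2002, VII §3 Thm. 7.39] -/
theorem rowNorm_eq_zero_iff_exists_kV :
    rowNorm (((g : UForm (Fin 2) (Fin 1)) : GL (Fin 2 ⊕ Fin 1) ℂ) : Matrix (Fin 2 ⊕ Fin 1) (Fin 2 ⊕ Fin 1) ℂ) = 0 ↔
      ∃ k : KV (Fin 2) (Fin 1), g = kV (Fin 2) (Fin 1) k := by
  constructor
  · intro h
    apply exists_kV_eq_of_gauge_eq_one (0 : Fin 1) g
    rw [gauge_eq_cosh_secT, (secT_eq_zero_iff _).2 h, Real.cosh_zero]
  · rintro ⟨k, rfl⟩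
    rw [rowNorm_eq_zero_iff, coe_kV, Matrix.fromBlocks_apply₂₁, Matrix.fromBlocks_apply₂₁, Matrix.zero_apply, Matrix.zero_apply]
    exact ⟨rfl, rfl⟩

/-- `‖r‖ ≠ 0 ↔ g ∉ K` (`K` = range of ★ `UForm.kV`). [cite: Knapp2002, VII §3 Thm. 7.39] -/
theorem rowNorm_ne_zero_iff_not_mem_range_kV :
    rowNorm (((g : UForm (Fin 2) (Fin 1)) : GL (Fin 2 ⊕ Fin 1) ℂ) : Matrix (Fin 2 ⊕ Fin 1) (Fin 2 ⊕ Fin 1) ℂ) ≠ 0 ↔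
      g ∉ Set.range (kV (Fin 2) (Fin 1)) := by
  rw [Ne, rowNorm_eq_zero_iff_exists_kV, Set.mem_range, not_iff_not]
  exact ⟨fun ⟨k, hk⟩ => ⟨k, hk.symm⟩, fun ⟨k, hk⟩ => ⟨k, hk.symm⟩⟩

/-- **`0 < secT g` off `K`**. [cite: Knapp2002, VII §3 Thm. 7.39] -/
theorem secT_pos_of_rowNorm_ne_zero {M : Matrix (Fin 2 ⊕ Fin 1) (Fin 2 ⊕ Fin 1) ℂ} (hr : rowNorm M ≠ 0) : 0 < secT M :=
  (secT_pos_iff M).2 hr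

/-! ### the packaged `K`-elements -/

/-- **`k₂` as an element of `K = U(2) × U(1)`** (★ `KV`), for any matrix with `‖r‖ ≠ 0` and `g₃₃ ≠ 0`. [cite: Knapp2002, VII §3 Thm. 7.39] -/
def secKV₂ (M : Matrix (Fin 2 ⊕ Fin 1) (Fin 2 ⊕ Fin 1) ℂ) (hr : rowNorm M ≠ 0) (hc : M (Sum.inr 0) (Sum.inr 0) ≠ 0) :
    KV (Fin 2) (Fin 1) :=
  (⟨secU M, secU_mem_unitaryGroup M hr⟩, ⟨secZ M, secZ_mem_unitaryGroup M hc⟩)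

/-- the matrix of `kV (secKV₂ g)` is `secK₂ g`. [cite: Knapp2002, VII §3 Thm. 7.39] -/
theorem coe_kV_secKV₂ (M : Matrix (Fin 2 ⊕ Fin 1) (Fin 2 ⊕ Fin 1) ℂ) (hr : rowNorm M ≠ 0) (hc : M (Sum.inr 0) (Sum.inr 0) ≠ 0) :
    (((kV (Fin 2) (Fin 1) (secKV₂ M hr hc) : UForm (Fin 2) (Fin 1)) : GL (Fin 2 ⊕ Fin 1) ℂ) : Matrix (Fin 2 ⊕ Fin 1) (Fin 2 ⊕ Fin 1) ℂ) =
      secK₂ M := by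
  rw [coe_kV]; rfl

/-- the matrix of `(kV (secKV₂ g))⁻¹` is `secK₂Inv g`. [cite: Knapp2002, VII §3 Thm. 7.39] -/
theorem coe_kV_secKV₂_inv (M : Matrix (Fin 2 ⊕ Fin 1) (Fin 2 ⊕ Fin 1) ℂ) (hr : rowNorm M ≠ 0) (hc : M (Sum.inr 0) (Sum.inr 0) ≠ 0) :
    ((((kV (Fin 2) (Fin 1) (secKV₂ M hr hc))⁻¹ : UForm (Fin 2) (Fin 1)) : GL (Fin 2 ⊕ Fin 1) ℂ) : Matrix (Fin 2 ⊕ Fin 1) (Fin 2 ⊕ Fin 1) ℂ) =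
      secK₂Inv M := by
  rw [← map_inv, coe_kV, Prod.fst_inv, Prod.snd_inv, Matrix.UnitaryGroup.inv_val, Matrix.UnitaryGroup.inv_val,
    Matrix.star_eq_conjTranspose, Matrix.star_eq_conjTranspose]
  rfl

/-- **`∃ k₂ ∈ K` with matrix `secK₂ g`**, for `g ∈ U(2,1)` off `K`. [cite: Knapp2002, VII §3 Thm. 7.39] -/
theorem exists_kV_coe_eq_secK₂ (hr : rowNorm (((g : UForm (Fin 2) (Fin 1)) : GL (Fin 2 ⊕ Fin 1) ℂ) : Matrix (Fin 2 ⊕ Fin 1) (Fin 2 ⊕ Fin 1) ℂ) ≠ 0) :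
    ∃ k : KV (Fin 2) (Fin 1), (((kV (Fin 2) (Fin 1) k : UForm (Fin 2) (Fin 1)) : GL (Fin 2 ⊕ Fin 1) ℂ) : Matrix (Fin 2 ⊕ Fin 1) (Fin 2 ⊕ Fin 1) ℂ) =
      secK₂ (((g : UForm (Fin 2) (Fin 1)) : GL (Fin 2 ⊕ Fin 1) ℂ) : Matrix (Fin 2 ⊕ Fin 1) (Fin 2 ⊕ Fin 1) ℂ) :=
  ⟨secKV₂ _ hr (corner_ne_zero g), coe_kV_secKV₂ _ hr (corner_ne_zero g)⟩

/-- the group element `g · k₂⁻¹ · a_{−secT g}` whose matrix is `secK₁ g`. [cite: Knapp2002, VII §3 Thm. 7.39] -/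
def secK₁Elt (hr : rowNorm (((g : UForm (Fin 2) (Fin 1)) : GL (Fin 2 ⊕ Fin 1) ℂ) : Matrix (Fin 2 ⊕ Fin 1) (Fin 2 ⊕ Fin 1) ℂ) ≠ 0) :
    UForm (Fin 2) (Fin 1) :=
  g * (kV (Fin 2) (Fin 1) (secKV₂ _ hr (corner_ne_zero g)))⁻¹ *
    hypV (0 : Fin 2) (0 : Fin 1) (-secT (((g : UForm (Fin 2) (Fin 1)) : GL (Fin 2 ⊕ Fin 1) ℂ) : Matrix (Fin 2 ⊕ Fin 1) (Fin 2 ⊕ Fin 1) ℂ))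

/-- the matrix of `secK₁Elt g` is `secK₁ g`. [cite: Knapp2002, VII §3 Thm. 7.39] -/
theorem coe_secK₁Elt (hr : rowNorm (((g : UForm (Fin 2) (Fin 1)) : GL (Fin 2 ⊕ Fin 1) ℂ) : Matrix (Fin 2 ⊕ Fin 1) (Fin 2 ⊕ Fin 1) ℂ) ≠ 0) :
    (((secK₁Elt g hr : UForm (Fin 2) (Fin 1)) : GL (Fin 2 ⊕ Fin 1) ℂ) : Matrix (Fin 2 ⊕ Fin 1) (Fin 2 ⊕ Fin 1) ℂ) =
      secK₁ (((g : UForm (Fin 2) (Fin 1)) : GL (Fin 2 ⊕ Fin 1) ℂ) : Matrix (Fin 2 ⊕ Fin 1) (Fin 2 ⊕ Fin 1) ℂ) := by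
  rw [secK₁Elt, UForm.coe_mul, UForm.coe_mul, coe_kV_secKV₂_inv]
  rfl

/-- **the last row of `k₁` on `U(2,1)` is `(0, 0, 1)`**: entries `(3,1)`, `(3,2)`. [cite: Knapp2002, VII §3 Thm. 7.39] -/
theorem secK₁_apply_inr_inl (hr : rowNorm (((g : UForm (Fin 2) (Fin 1)) : GL (Fin 2 ⊕ Fin 1) ℂ) : Matrix (Fin 2 ⊕ Fin 1) (Fin 2 ⊕ Fin 1) ℂ) ≠ 0)
    (a : Fin 2) :
    secK₁ (((g : UForm (Fin 2) (Fin 1)) : GL (Fin 2 ⊕ Fin 1) ℂ) : Matrix (Fin 2 ⊕ Fin 1) (Fin 2 ⊕ Fin 1) ℂ) (Sum.inr 0) (Sum.inl a) = 0 := by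
  fin_cases a
  · exact secK₁_apply_inr_inl_zero_of _ hr (norm_corner_eq_cosh_secT g) (corner_ne_zero g)
  · exact secK₁_apply_inr_inl_one _ hr (corner_ne_zero g)

/-- **the corner of `k₁` on `U(2,1)` is `1`**. [cite: Knapp2002, VII §3 Thm. 7.39] -/
theorem secK₁_apply_inr_inr (hr : rowNorm (((g : UForm (Fin 2) (Fin 1)) : GL (Fin 2 ⊕ Fin 1) ℂ) : Matrix (Fin 2 ⊕ Fin 1) (Fin 2 ⊕ Fin 1) ℂ) ≠ 0) :
    secK₁ (((g : UForm (Fin 2) (Fin 1)) : GL (Fin 2 ⊕ Fin 1) ℂ) : Matrix (Fin 2 ⊕ Fin 1) (Fin 2 ⊕ Fin 1) ℂ) (Sum.inr 0) (Sum.inr 0) = 1 :=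
  secK₁_apply_inr_inr_of _ hr (norm_corner_eq_cosh_secT g) (corner_ne_zero g)

/-- **`∃ k₁ ∈ K` with matrix `secK₁ g`**, for `g ∈ U(2,1)` off `K` (the gauge of `secK₁Elt g` is `|1| = 1`, ★ `exists_kV_eq_of_gauge_eq_one`).
[cite: Knapp2002, VII §3 Thm. 7.39] -/
theorem exists_kV_coe_eq_secK₁ (hr : rowNorm (((g : UForm (Fin 2) (Fin 1)) : GL (Fin 2 ⊕ Fin 1) ℂ) : Matrix (Fin 2 ⊕ Fin 1) (Fin 2 ⊕ Fin 1) ℂ) ≠ 0) :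
    ∃ k : KV (Fin 2) (Fin 1), (((kV (Fin 2) (Fin 1) k : UForm (Fin 2) (Fin 1)) : GL (Fin 2 ⊕ Fin 1) ℂ) : Matrix (Fin 2 ⊕ Fin 1) (Fin 2 ⊕ Fin 1) ℂ) =
      secK₁ (((g : UForm (Fin 2) (Fin 1)) : GL (Fin 2 ⊕ Fin 1) ℂ) : Matrix (Fin 2 ⊕ Fin 1) (Fin 2 ⊕ Fin 1) ℂ) := by
  have hg : gauge (0 : Fin 1) (secK₁Elt g hr) = 1 := by
    rw [gauge, coe_secK₁Elt, secK₁_apply_inr_inr g hr, norm_one]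
  obtain ⟨k, hk⟩ := exists_kV_eq_of_gauge_eq_one (0 : Fin 1) (secK₁Elt g hr) hg
  exact ⟨k, by rw [← hk, coe_secK₁Elt]⟩

/-- `secK₁Elt g ∈ K` (range of ★ `UForm.kV`). [cite: Knapp2002, VII §3 Thm. 7.39] -/
theorem secK₁Elt_mem_range_kV (hr : rowNorm (((g : UForm (Fin 2) (Fin 1)) : GL (Fin 2 ⊕ Fin 1) ℂ) : Matrix (Fin 2 ⊕ Fin 1) (Fin 2 ⊕ Fin 1) ℂ) ≠ 0) :
    secK₁Elt g hr ∈ Set.range (kV (Fin 2) (Fin 1)) := by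
  have hg : gauge (0 : Fin 1) (secK₁Elt g hr) = 1 := by
    rw [gauge, coe_secK₁Elt, secK₁_apply_inr_inr g hr, norm_one]
  obtain ⟨k, hk⟩ := exists_kV_eq_of_gauge_eq_one (0 : Fin 1) (secK₁Elt g hr) hg
  exact ⟨k, hk.symm⟩

/-- **THE SECTION IDENTITY on `U(2,1)`**: `g = secK₁ g · a_{secT g} · secK₂ g` as matrices, for `g` off `K`. [cite: Knapp2002, VII §3 Thm. 7.39] -/
theorem coe_eq_secK₁_mul_hypV_mul_secK₂ (hr : rowNorm (((g : UForm (Fin 2) (Fin 1)) : GL (Fin 2 ⊕ Fin 1) ℂ) : Matrix (Fin 2 ⊕ Fin 1) (Fin 2 ⊕ Fin 1) ℂ) ≠ 0) :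
    (((g : UForm (Fin 2) (Fin 1)) : GL (Fin 2 ⊕ Fin 1) ℂ) : Matrix (Fin 2 ⊕ Fin 1) (Fin 2 ⊕ Fin 1) ℂ) =
      secK₁ (((g : UForm (Fin 2) (Fin 1)) : GL (Fin 2 ⊕ Fin 1) ℂ) : Matrix (Fin 2 ⊕ Fin 1) (Fin 2 ⊕ Fin 1) ℂ) *
        (((hypV (0 : Fin 2) (0 : Fin 1) (secT (((g : UForm (Fin 2) (Fin 1)) : GL (Fin 2 ⊕ Fin 1) ℂ) : Matrix (Fin 2 ⊕ Fin 1) (Fin 2 ⊕ Fin 1) ℂ)) :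
            UForm (Fin 2) (Fin 1)) : GL (Fin 2 ⊕ Fin 1) ℂ) : Matrix (Fin 2 ⊕ Fin 1) (Fin 2 ⊕ Fin 1) ℂ) *
        secK₂ (((g : UForm (Fin 2) (Fin 1)) : GL (Fin 2 ⊕ Fin 1) ℂ) : Matrix (Fin 2 ⊕ Fin 1) (Fin 2 ⊕ Fin 1) ℂ) :=
  (secK₁_mul_hypV_mul_secK₂ _ hr (corner_ne_zero g)).symm

/-- **THE SECTION THROUGH `kakMap`**: off `K`, `g = kakMap 0 0 (k₁, secT g, k₂)` with `k₁, k₂ ∈ K` of matrices `secK₁ g`, `secK₂ g`. [cite: Knapp2002, VII §3 Thm. 7.39] -/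
theorem exists_kakMap_eq (hr : rowNorm (((g : UForm (Fin 2) (Fin 1)) : GL (Fin 2 ⊕ Fin 1) ℂ) : Matrix (Fin 2 ⊕ Fin 1) (Fin 2 ⊕ Fin 1) ℂ) ≠ 0) :
    ∃ k₁ k₂ : KV (Fin 2) (Fin 1),
      (((kV (Fin 2) (Fin 1) k₁ : UForm (Fin 2) (Fin 1)) : GL (Fin 2 ⊕ Fin 1) ℂ) : Matrix (Fin 2 ⊕ Fin 1) (Fin 2 ⊕ Fin 1) ℂ) =
          secK₁ (((g : UForm (Fin 2) (Fin 1)) : GL (Fin 2 ⊕ Fin 1) ℂ) : Matrix (Fin 2 ⊕ Fin 1) (Fin 2 ⊕ Fin 1) ℂ) ∧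
      (((kV (Fin 2) (Fin 1) k₂ : UForm (Fin 2) (Fin 1)) : GL (Fin 2 ⊕ Fin 1) ℂ) : Matrix (Fin 2 ⊕ Fin 1) (Fin 2 ⊕ Fin 1) ℂ) =
          secK₂ (((g : UForm (Fin 2) (Fin 1)) : GL (Fin 2 ⊕ Fin 1) ℂ) : Matrix (Fin 2 ⊕ Fin 1) (Fin 2 ⊕ Fin 1) ℂ) ∧
      kakMap (0 : Fin 2) (0 : Fin 1) (k₁, secT (((g : UForm (Fin 2) (Fin 1)) : GL (Fin 2 ⊕ Fin 1) ℂ) : Matrix (Fin 2 ⊕ Fin 1) (Fin 2 ⊕ Fin 1) ℂ), k₂) = g := by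
  obtain ⟨k₁, hk₁⟩ := exists_kV_coe_eq_secK₁ g hr
  obtain ⟨k₂, hk₂⟩ := exists_kV_coe_eq_secK₂ g hr
  refine ⟨k₁, k₂, hk₁, hk₂, ?_⟩
  apply Subtype.ext
  apply Units.ext
  rw [kakMap_apply, UForm.coe_mul, UForm.coe_mul, hk₁, hk₂]
  exact (coe_eq_secK₁_mul_hypV_mul_secK₂ g hr).symm

/-! ### the fully explicit section `g ↦ (secKV₁ g, secT g, secKV₂ g)` -/

/-- the `(1,2)`-block of `k₁` vanishes on `U(2,1)` (off `K`): `(secK₁ g)_{a,3} = 0`. [cite: Knapp2002, VII §3 Thm. 7.39] -/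
theorem secK₁_apply_inl_inr (hr : rowNorm (((g : UForm (Fin 2) (Fin 1)) : GL (Fin 2 ⊕ Fin 1) ℂ) : Matrix (Fin 2 ⊕ Fin 1) (Fin 2 ⊕ Fin 1) ℂ) ≠ 0)
    (a : Fin 2) :
    secK₁ (((g : UForm (Fin 2) (Fin 1)) : GL (Fin 2 ⊕ Fin 1) ℂ) : Matrix (Fin 2 ⊕ Fin 1) (Fin 2 ⊕ Fin 1) ℂ) (Sum.inl a) (Sum.inr 0) = 0 := by
  obtain ⟨k, hk⟩ := exists_kV_coe_eq_secK₁ g hr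
  rw [← hk, coe_kV, Matrix.fromBlocks_apply₁₂, Matrix.zero_apply]

/-- **`secU₁ g ∈ U(2)`** for `g ∈ U(2,1)` off `K` (it is the `U(2)`-block of `k₁ ∈ K`). [cite: Knapp2002, VII §3 Thm. 7.39] -/
theorem secU₁_mem_unitaryGroup (hr : rowNorm (((g : UForm (Fin 2) (Fin 1)) : GL (Fin 2 ⊕ Fin 1) ℂ) : Matrix (Fin 2 ⊕ Fin 1) (Fin 2 ⊕ Fin 1) ℂ) ≠ 0) :
    secU₁ (((g : UForm (Fin 2) (Fin 1)) : GL (Fin 2 ⊕ Fin 1) ℂ) : Matrix (Fin 2 ⊕ Fin 1) (Fin 2 ⊕ Fin 1) ℂ) ∈ Matrix.unitaryGroup (Fin 2) ℂ := by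
  obtain ⟨k, hk⟩ := exists_kV_coe_eq_secK₁ g hr
  have h : secU₁ (((g : UForm (Fin 2) (Fin 1)) : GL (Fin 2 ⊕ Fin 1) ℂ) : Matrix (Fin 2 ⊕ Fin 1) (Fin 2 ⊕ Fin 1) ℂ) = (k.1 : Matrix (Fin 2) (Fin 2) ℂ) := by
    ext a a'
    rw [secU₁, Matrix.of_apply, ← hk, coe_kV, Matrix.fromBlocks_apply₁₁]
  rw [h]
  exact k.1.2

/-- **`k₁` as an element of `K = U(2) × U(1)`**: `(secU₁ g, 1)`. [cite: Knapp2002, VII §3 Thm. 7.39] -/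
def secKV₁ (hr : rowNorm (((g : UForm (Fin 2) (Fin 1)) : GL (Fin 2 ⊕ Fin 1) ℂ) : Matrix (Fin 2 ⊕ Fin 1) (Fin 2 ⊕ Fin 1) ℂ) ≠ 0) :
    KV (Fin 2) (Fin 1) :=
  (⟨secU₁ (((g : UForm (Fin 2) (Fin 1)) : GL (Fin 2 ⊕ Fin 1) ℂ) : Matrix (Fin 2 ⊕ Fin 1) (Fin 2 ⊕ Fin 1) ℂ), secU₁_mem_unitaryGroup g hr⟩, 1)

/-- the matrix of `kV (secKV₁ g)` is `secK₁ g`. [cite: Knapp2002, VII §3 Thm. 7.39] -/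
theorem coe_kV_secKV₁ (hr : rowNorm (((g : UForm (Fin 2) (Fin 1)) : GL (Fin 2 ⊕ Fin 1) ℂ) : Matrix (Fin 2 ⊕ Fin 1) (Fin 2 ⊕ Fin 1) ℂ) ≠ 0) :
    (((kV (Fin 2) (Fin 1) (secKV₁ g hr) : UForm (Fin 2) (Fin 1)) : GL (Fin 2 ⊕ Fin 1) ℂ) : Matrix (Fin 2 ⊕ Fin 1) (Fin 2 ⊕ Fin 1) ℂ) =
      secK₁ (((g : UForm (Fin 2) (Fin 1)) : GL (Fin 2 ⊕ Fin 1) ℂ) : Matrix (Fin 2 ⊕ Fin 1) (Fin 2 ⊕ Fin 1) ℂ) := by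
  rw [coe_kV]
  ext i j
  rcases i with a | b <;> rcases j with a' | b'
  · rw [Matrix.fromBlocks_apply₁₁]; rfl
  · rw [Matrix.fromBlocks_apply₁₂, Matrix.zero_apply, Subsingleton.elim b' 0, secK₁_apply_inl_inr g hr]
  · rw [Matrix.fromBlocks_apply₂₁, Matrix.zero_apply, Subsingleton.elim b 0, secK₁_apply_inr_inl g hr]
  · rw [Matrix.fromBlocks_apply₂₂, Subsingleton.elim b 0, Subsingleton.elim b' 0, secK₁_apply_inr_inr g hr]
    rfl

/-- **THE EXPLICIT SECTION THROUGH `kakMap`**: `kakMap 0 0 (secKV₁ g, secT g, secKV₂ g) = g` for `g ∈ U(2,1)` off `K`. [cite: Knapp2002, VII §3 Thm. 7.39] -/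
theorem kakMap_secKV (hr : rowNorm (((g : UForm (Fin 2) (Fin 1)) : GL (Fin 2 ⊕ Fin 1) ℂ) : Matrix (Fin 2 ⊕ Fin 1) (Fin 2 ⊕ Fin 1) ℂ) ≠ 0) :
    kakMap (0 : Fin 2) (0 : Fin 1)
        (secKV₁ g hr, secT (((g : UForm (Fin 2) (Fin 1)) : GL (Fin 2 ⊕ Fin 1) ℂ) : Matrix (Fin 2 ⊕ Fin 1) (Fin 2 ⊕ Fin 1) ℂ),
          secKV₂ _ hr (corner_ne_zero g)) = g := by
  apply Subtype.ext
  apply Units.ext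
  rw [kakMap_apply, UForm.coe_mul, UForm.coe_mul, coe_kV_secKV₁, coe_kV_secKV₂]
  exact (coe_eq_secK₁_mul_hypV_mul_secK₂ g hr).symm

end OnGroup

end RealDualPair

end Literature.RepresentationTheory.KonnoKonno2007

end
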